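import Summits.BirchSwinnertonDyer.BirchSwinnertonDyer.Theorems.ManinLocalTwoThreeShimuraRationalTwoTorsionAnyModel
import Literature.NumberTheory.EllipticCurves.ModularCurveNeronLatticeProofs
import HarnessLib

/-!
# Vélu rigidity at `2`, ANY model: a doubled optimal pair (`|c₀| = 2|c₁|`, `4 ∣ N`) makes the MINIMAL model `W₁` the
# `u = 1` Vélu `2`-quotient of `W₀` by a rational `2`-torsion point — or `Λ₁(f) = 2Λ₀(f)`

Summit `BirchSwinnertonDyer`, route `ManinLocalTwoThree` (cell bsd-f2-manin), deciding crux C2 `ManinOddAtFour`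
(stmt-BirchSwinnertonDyer-22967).  `…BlindNoDoubling` (p634444) ran the Vélu step for models `W₀ = [0, a₂, 0, a₄, a₆]` and a
Kummer-BLIND root; here the shape-free RIGIDITY statement behind it (the `2`-adic twin of `…ThirdLatticeVelu`), from
`PeriodPair.lattice_eq_of_velu_invariants` (p632972), the any-model trichotomy (p637935) and the dictionary
`Ψ₂Sq(℘(z₀) − b₂/12) = 0` (`PeriodPair.eval_ΨSq_weierstrassP_eq_zero_iff`):

* `velu_two_rigidity` — `W₀/ℚ` elliptic (any model) with Néron pair `L₀`; `L'` with RATIONAL invariants `(A, B)`, `Λ₀ ⊆ Λ'`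
  of index `2` generated by the half-period `z₀`: then `q = ℘_{Λ₀}(z₀) ∈ ℚ`, `W₀.Ψ₂Sq(q − b₂/12) = 0`, and
  `A = 60q² − 4·c₄(W₀)/12`, `B = 88q³ − 8(c₄(W₀)/12)q` EXACTLY (Vélu, `u = 1`);
* `index_four_or_velu_two_of_doubled` — optimal pair at `4 ∣ N` with `|c₀| = 2|c₁|`: `Λ₁(f) = 2Λ₀(f)`, or `∃ q`,
  `W₀.Ψ₂Sq(q − b₂/12) = 0 ∧ c₄(W₁) = 720q² − 4c₄(W₀) ∧ c₆(W₁) = 19008q³ − 144c₄(W₀)q` on the MINIMAL model `W₁`;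
* `velu_two_of_doubled_four_mul_prime` — at `N = 4p` (no index `4`, p632017): **doubling forces that rigidity** — the E-an-54 /
  E-an-67 dictionary for every globally minimal `W₀`, the blind/non-blind analysis being pure `2`-adic arithmetic of `q`.

HONEST FRAMING: structure only; C2, Manin's conjecture and BSD are not proved.  No definitions.
-/

set_option autoImplicit false
-- the summit-side namespace `Summit.BirchSwinnertonDyer.BirchSwinnertonDyer.…` is the tree's (summit = sub-problem)
set_option linter.dupNamespace false

noncomputable section

open WeierstrassCurve Literature.NumberTheory.EllipticCurves Literature.NumberTheory.EllipticCurves.ModularForms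
open CongruenceSubgroup Polynomial

namespace Summit.BirchSwinnertonDyer.BirchSwinnertonDyer.Theorems.ManinLocalTwoThree

variable {W₁ W₀ : WeierstrassCurve ℚ} [W₁.IsElliptic] [W₁.IsGloballyMinimal] [W₀.IsElliptic]
  [W₀.IsGloballyMinimal] {N : ℕ} [NeZero N]

/-! ### From `℘_{Λ₀}(z₀) = q ∈ ℚ` (half-period) to the `Ψ₂Sq`-root and the cubic relation -/

omit [W₀.IsElliptic] [W₀.IsGloballyMinimal] in
/-- For a half-period `z₀` of the Néron lattice of `W₀` with `℘(z₀) = q ∈ ℚ`: `q − b₂/12` is a root of `W₀.Ψ₂Sq`, and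
`4q³ − g₂q − g₃ = 0` with `g₂ = c₄(W₀)/12`, `g₃ = c₆(W₀)/216`. -/
theorem Ψ₂Sq_root_of_ratCast_eq_weierstrassP {L₀ : PeriodPair} (hL₀ : IsNeronLatticeOf (W₀.baseChange ℂ) L₀)
    {z₀ : ℂ} (hz₀ : z₀ ∉ L₀.lattice) (h2 : 2 * z₀ ∈ L₀.lattice) {q : ℚ} (hq : (q : ℂ) = L₀.weierstrassP z₀) :
    W₀.Ψ₂Sq.eval (q - W₀.b₂ / 12) = 0 ∧ 4 * q ^ 3 - (W₀.c₄ / 12) * q - W₀.c₆ / 216 = 0 := by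
  have hc₄ : (W₀.baseChange ℂ).c₄ = (W₀.c₄ : ℂ) := by simp [WeierstrassCurve.baseChange, WeierstrassCurve.map_c₄]
  have hc₆ : (W₀.baseChange ℂ).c₆ = (W₀.c₆ : ℂ) := by simp [WeierstrassCurve.baseChange, WeierstrassCurve.map_c₆]
  have hg₂ : L₀.g₂ = ((W₀.c₄ / 12 : ℚ) : ℂ) := by rw [hL₀.1, hc₄]; push_cast; ring
  have hg₃ : L₀.g₃ = ((W₀.c₆ / 216 : ℚ) : ℂ) := by rw [hL₀.2, hc₆]; push_cast; ring
  have hcub : 4 * L₀.weierstrassP z₀ ^ 3 - L₀.g₂ * L₀.weierstrassP z₀ - L₀.g₃ = 0 := by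
    rw [← L₀.derivWeierstrassP_sq z₀ hz₀, L₀.derivWeierstrassP_eq_zero_of_two_mul_mem h2]; ring
  rw [← hq, hg₂, hg₃] at hcub
  have hcubQ : 4 * q ^ 3 - (W₀.c₄ / 12) * q - W₀.c₆ / 216 = 0 := by
    have h : ((4 * q ^ 3 - (W₀.c₄ / 12) * q - W₀.c₆ / 216 : ℚ) : ℂ) = 0 := by push_cast at hcub ⊢; exact hcub
    exact_mod_cast h
  refine ⟨?_, hcubQ⟩
  rw [Ψ₂Sq_eval_sub_b₂_div_twelve]
  simp only [WeierstrassCurve.Ψ₂Sq, WeierstrassCurve.b₂, WeierstrassCurve.b₄, WeierstrassCurve.b₆,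
    eval_add, eval_mul, eval_pow, eval_C, eval_X]
  linear_combination hcubQ

/-! ### Vélu rigidity at `2` -/

omit [W₀.IsGloballyMinimal] in
/-- **Vélu rigidity at `2`, any model.**  `W₀/ℚ` elliptic with Néron-type pair `L₀`; `L'` a period pair with RATIONAL invariants
`g₂(L') = A`, `g₃(L') = B`; `Λ₀ ⊆ Λ' ⊆ Λ₀ ∪ (z₀ + Λ₀)` with `z₀ ∈ Λ' ∖ Λ₀`, `2z₀ ∈ Λ₀`.  Then `q = ℘_{Λ₀}(z₀) ∈ ℚ`,
`W₀.Ψ₂Sq(q − b₂/12) = 0` (a rational `2`-torsion point `T`), and `(A, B)` ARE Vélu's invariants of `E₀/⟨T⟩`: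
`A = 60q² − 4·c₄(W₀)/12`, `B = 88q³ − 8(c₄(W₀)/12)q`. -/
theorem velu_two_rigidity {L₀ : PeriodPair} (hL₀ : IsNeronLatticeOf (W₀.baseChange ℂ) L₀) (L' : PeriodPair)
    {A B : ℚ} (hA : (A : ℂ) = L'.g₂) (hB : (B : ℂ) = L'.g₃) (hle : L₀.lattice ≤ L'.lattice)
    {z₀ : ℂ} (hz₀' : z₀ ∈ L'.lattice) (hz₀ : z₀ ∉ L₀.lattice) (h2 : 2 * z₀ ∈ L₀.lattice)
    (hidx : ∀ w ∈ L'.lattice, w ∈ L₀.lattice ∨ w - z₀ ∈ L₀.lattice) :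
    ∃ q : ℚ, (q : ℂ) = L₀.weierstrassP z₀ ∧ W₀.Ψ₂Sq.eval (q - W₀.b₂ / 12) = 0 ∧
      A = 60 * q ^ 2 - 4 * (W₀.c₄ / 12) ∧ B = 88 * q ^ 3 - 8 * (W₀.c₄ / 12) * q := by
  have hc₄ : (W₀.baseChange ℂ).c₄ = (W₀.c₄ : ℂ) := by simp [WeierstrassCurve.baseChange, WeierstrassCurve.map_c₄]
  have hc₆ : (W₀.baseChange ℂ).c₆ = (W₀.c₆ : ℂ) := by simp [WeierstrassCurve.baseChange, WeierstrassCurve.map_c₆]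
  have hg₂ : L₀.g₂ = ((W₀.c₄ / 12 : ℚ) : ℂ) := by rw [hL₀.1, hc₄]; push_cast; ring
  have hg₃ : L₀.g₃ = ((W₀.c₆ / 216 : ℚ) : ℂ) := by rw [hL₀.2, hc₆]; push_cast; ring
  obtain ⟨q, hq⟩ := L₀.exists_ratCast_eq_weierstrassP_of_index_two L' hle ⟨_, hg₂.symm⟩ ⟨_, hg₃.symm⟩
    ⟨A, hA⟩ ⟨B, hB⟩ hz₀' hz₀ hidx
  obtain ⟨hroot, hcub⟩ := Ψ₂Sq_root_of_ratCast_eq_weierstrassP hL₀ hz₀ h2 hq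
  refine ⟨q, hq, hroot, ?_⟩
  set g₂' : ℚ := W₀.c₄ / 12 with hg₂'
  set g₃' : ℚ := W₀.c₆ / 216 with hg₃'
  set B' : ℚ := 3 * q ^ 2 - g₂' / 4 with hB'
  have hΔ₀ : g₂' ^ 3 - 27 * g₃' ^ 2 ≠ 0 := by
    have hΔW : W₀.Δ ≠ 0 := by rw [← WeierstrassCurve.coe_Δ']; exact W₀.Δ'.ne_zero
    intro h0; apply hΔW
    have hc := W₀.c_relation
    rw [hg₂', hg₃'] at h0
    linear_combination hc / 1728 + h0
  -- `B' ≠ 0` and `(3q)² − 4B' ≠ 0`: else the cubic `4x³ − g₂x − g₃` has the double root `q`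
  have hB0 : B' ≠ 0 := by
    intro h0; apply hΔ₀
    have hg : g₂' = 12 * q ^ 2 := by linear_combination -4 * h0
    have hg3 : g₃' = -8 * q ^ 3 := by rw [hg] at hcub; linear_combination -hcub
    rw [hg, hg3]; ring
  have hAB : (3 * q) ^ 2 - 4 * B' ≠ 0 := by
    intro h0; apply hΔ₀
    have hg : g₂' = 3 * q ^ 2 := by linear_combination h0
    have hg3 : g₃' = q ^ 3 := by rw [hg] at hcub; linear_combination -hcub
    rw [hg, hg3]; ring
  -- Vélu's model and its Néron pair
  set V : WeierstrassCurve ℚ := ⟨0, -2 * (3 * q), 0, (3 * q) ^ 2 - 4 * B', 0⟩ with hV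
  haveI hVell : V.IsElliptic := velu_isElliptic hB0 hAB
  haveI : (V.baseChange ℂ).IsElliptic := by rw [WeierstrassCurve.baseChange]; infer_instance
  obtain ⟨LV, hLV⟩ := exists_isNeronLatticeOf_holds (V.baseChange ℂ)
  have hc₄V : (V.baseChange ℂ).c₄ = (V.c₄ : ℂ) := by simp [WeierstrassCurve.baseChange, WeierstrassCurve.map_c₄]
  have hc₆V : (V.baseChange ℂ).c₆ = (V.c₆ : ℂ) := by simp [WeierstrassCurve.baseChange, WeierstrassCurve.map_c₆]
  have hVc₄ : V.c₄ / 12 = 12 * q ^ 2 + 16 * B' := velu_c₄_div (K := ℚ) q B'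
  have hVc₆ : V.c₆ / 216 = -8 * q ^ 3 + 32 * B' * q := velu_c₆_div (K := ℚ) q B'
  have hBc : ((B' : ℚ) : ℂ) = 3 * L₀.weierstrassP z₀ ^ 2 - L₀.g₂ / 4 := by
    rw [hB', ← hq, hg₂]; push_cast; ring
  have hB0c : ((B' : ℚ) : ℂ) ≠ 0 := by exact_mod_cast hB0
  have h₂V : LV.g₂ = 12 * L₀.weierstrassP z₀ ^ 2 + 16 * ((B' : ℚ) : ℂ) := by
    rw [hLV.1, hc₄V, ← hq]
    have h : ((V.c₄ / 12 : ℚ) : ℂ) = ((12 * q ^ 2 + 16 * B' : ℚ) : ℂ) := by rw [hVc₄]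
    push_cast at h ⊢; exact h
  have h₃V : LV.g₃ = -8 * L₀.weierstrassP z₀ ^ 3 + 32 * ((B' : ℚ) : ℂ) * L₀.weierstrassP z₀ := by
    rw [hLV.2, hc₆V, ← hq]
    have h : ((V.c₆ / 216 : ℚ) : ℂ) = ((-8 * q ^ 3 + 32 * B' * q : ℚ) : ℂ) := by rw [hVc₆]
    push_cast at h ⊢; exact h
  obtain ⟨hleV, hz₀V, hidxV⟩ := L₀.lattice_eq_of_velu_invariants hz₀ h2 hBc hB0c LV h₂V h₃V
  have hΛ : LV.lattice = L'.lattice := by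
    ext w
    constructor
    · intro hw
      rcases hidxV w hw with h0 | h0
      · exact hle h0
      · have e' : w = (w - z₀) + z₀ := by ring
        rw [e']; exact add_mem (hle h0) hz₀'
    · intro hw
      rcases hidx w hw with h0 | h0
      · exact hleV h0
      · have e' : w = (w - z₀) + z₀ := by ring
        rw [e']; exact add_mem (hleV h0) hz₀V
  have hA' : (A : ℂ) = ((12 * q ^ 2 + 16 * B' : ℚ) : ℂ) := by
    rw [hA, ← PeriodPair.g₂_eq_of_lattice_eq hΛ, hLV.1, hc₄V, ← hVc₄]; push_cast; ring
  have hB'' : (B : ℂ) = ((-8 * q ^ 3 + 32 * B' * q : ℚ) : ℂ) := by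
    rw [hB, ← PeriodPair.g₃_eq_of_lattice_eq hΛ, hLV.2, hc₆V, ← hVc₆]; push_cast; ring
  have hA1 : A = 12 * q ^ 2 + 16 * B' := by exact_mod_cast hA'
  have hB1 : B = -8 * q ^ 3 + 32 * B' * q := by exact_mod_cast hB''
  exact ⟨by rw [hA1, hB']; ring, by rw [hB1, hB']; ring⟩

/-! ### The doubled optimal pair at `4 ∣ N` -/

/-- **Doubled ⟹ index `4` or Vélu rigidity (any model).**  For the optimal `X₁(N)`-datum `D₁` and the optimal `X₀(N)`-datum
`D₀` of a class at `4 ∣ N` with `|c₀| = 2|c₁|`: either `Λ₁(f) = 2Λ₀(f)`, or there is `q ∈ ℚ` with `W₀.Ψ₂Sq(q − b₂/12) = 0` (a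
rational `2`-torsion point `T`) such that the globally minimal `W₁` has EXACTLY the Vélu invariants
`c₄(W₁) = 720q² − 4c₄(W₀)`, `c₆(W₁) = 19008q³ − 144c₄(W₀)q` (`E₁ = E₀/⟨T⟩` with `u = 1`). -/
theorem index_four_or_velu_two_of_doubled (D₁ : Gamma1ParametrizationData W₁ N)
    (D₀ : ModularParametrizationData W₀ N) (hiso : IsIsogenous W₁ W₀) (h₁ : D₁.IsOptimal)
    (h₀ : ∀ z ∈ D₀.L.lattice, ∃ w ∈ periodLattice D₀.f, z = D₀.c * w) (h4 : 2 ^ 2 ∣ N)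
    (hdouble : D₀.maninConstant.natAbs = 2 * D₁.maninConstant.natAbs) :
    (∀ z : ℂ, z ∈ periodLatticeGamma1 D₀.f ↔ ∃ w ∈ periodLattice D₀.f, z = 2 * w) ∨
      ∃ q : ℚ, W₀.Ψ₂Sq.eval (q - W₀.b₂ / 12) = 0 ∧ W₁.c₄ = 720 * q ^ 2 - 4 * W₀.c₄ ∧
        W₁.c₆ = 19008 * q ^ 3 - 144 * W₀.c₄ * q := by
  have hf : D₁.f = D₀.f := D₁.f_eq_of_isIsogenous D₀ hiso
  have hc₁ : (D₁.c : ℂ) ≠ 0 := by exact_mod_cast D₁.maninConstant_ne_zero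
  have hc₄W₁ : (W₁.baseChange ℂ).c₄ = (W₁.c₄ : ℂ) := by simp [WeierstrassCurve.baseChange, WeierstrassCurve.map_c₄]
  have hc₆W₁ : (W₁.baseChange ℂ).c₆ = (W₁.c₆ : ℂ) := by simp [WeierstrassCurve.baseChange, WeierstrassCurve.map_c₆]
  have hA : ((W₁.c₄ / 12 : ℚ) : ℂ) = D₁.L.g₂ := by rw [D₁.isNeronLattice.1, hc₄W₁]; push_cast; ring
  have hB : ((W₁.c₆ / 216 : ℚ) : ℂ) = D₁.L.g₃ := by rw [D₁.isNeronLattice.2, hc₆W₁]; push_cast; ring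
  -- Ling–Oesterlé at `2`
  have h2Λ : ∀ w ∈ periodLattice D₀.f, (2 : ℂ) * w ∈ periodLatticeGamma1 D₀.f := fun w hw ↦ by
    have h := pMulLatticeLeGamma1OfTracelessPrime_holds N D₀.f D₀.isNewformOf.1 2 Nat.prime_two
      ((dvd_pow_self 2 two_ne_zero).trans h4) (D₀.isNewformOf.1.cuspCoeff_eq_zero_of_sq_dvd Nat.prime_two h4) w hw
    exact_mod_cast h
  obtain ⟨ε, hε, hcc⟩ : ∃ ε : ℂ, (ε = 1 ∨ ε = -1) ∧ (D₀.c : ℂ) = ε * (2 * D₁.c) := by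
    have h : D₀.maninConstant.natAbs = (2 * D₁.maninConstant).natAbs := by rw [hdouble, Int.natAbs_mul]; rfl
    rcases Int.natAbs_eq_natAbs_iff.mp h with h' | h'
    · exact ⟨1, Or.inl rfl, by rw [one_mul]; exact_mod_cast h'⟩
    · exact ⟨-1, Or.inr rfl, by rw [neg_one_mul]; exact_mod_cast h'⟩
  have hε2 : ε * ε = 1 := by rcases hε with rfl | rfl <;> norm_num
  have hεmem : ∀ (S : AddSubgroup ℂ) (w : ℂ), w ∈ S → ε * w ∈ S := by
    intro S w hw; rcases hε with rfl | rfl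
    · rwa [one_mul]
    · rw [neg_one_mul]; exact neg_mem hw
  have hle : D₀.L.lattice ≤ D₁.L.lattice := by
    intro z hz
    obtain ⟨w, hw, rfl⟩ := h₀ z hz
    have e : (D₀.c : ℂ) * w = (D₁.c : ℂ) * (ε * (2 * w)) := by rw [hcc]; ring
    rw [e]
    exact D₁.smul_periodLatticeGamma1_le _ (hεmem _ _ (by rw [hf]; exact h2Λ w hw))
  have htwo : ∀ w ∈ D₁.L.lattice, 2 * w ∈ D₀.L.lattice := by
    intro w hw
    obtain ⟨w₁, hw₁, rfl⟩ := h₁ w hw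
    have hw₀ : ε * w₁ ∈ periodLattice D₀.f := hεmem _ _ (hf ▸ periodLatticeGamma1_le_periodLattice D₁.f hw₁)
    have e : 2 * ((D₁.c : ℂ) * w₁) = (D₀.c : ℂ) * (ε * w₁) := by
      rw [hcc]; linear_combination -(2 * (D₁.c : ℂ) * w₁) * hε2
    rw [e]; exact D₀.smul_periodLattice_le _ hw₀
  rcases halfLattice_trichotomy D₀.L D₁.L hle htwo with hcase | hcase | hcase
  · -- `Λ_{E₁} = Λ_{E₀}`: index 4
    left
    refine fun z ↦ ⟨fun hz ↦ ?_, by rintro ⟨w, hw, rfl⟩; exact h2Λ w hw⟩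
    have hz' : (D₁.c : ℂ) * z ∈ D₀.L.lattice := hcase _ (D₁.smul_periodLatticeGamma1_le z (hf ▸ hz))
    obtain ⟨w, hw, hw'⟩ := h₀ _ hz'
    refine ⟨ε * w, hεmem _ _ hw, ?_⟩
    have h : (D₁.c : ℂ) * z = (D₁.c : ℂ) * (2 * (ε * w)) := by rw [hw', hcc]; ring
    exact mul_left_cancel₀ hc₁ h
  · -- `Λ_{E₁} ⊇ ½Λ_{E₀}`: `Λ₁ = Λ₀`, so `|c₀| = |c₁|`, contradicting `|c₀| = 2|c₁| ≠ 0`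
    exfalso
    have hΛ : periodLatticeGamma1 D₀.f = periodLattice D₀.f := by
      refine le_antisymm (periodLatticeGamma1_le_periodLattice D₀.f) fun w hw ↦ ?_
      have h2h : 2 * (ε * ((D₁.c : ℂ) * w)) ∈ D₀.L.lattice := by
        have e : 2 * (ε * ((D₁.c : ℂ) * w)) = (D₀.c : ℂ) * w := by rw [hcc]; ring
        rw [e]; exact D₀.smul_periodLattice_le w hw
      obtain ⟨w₁, hw₁, hw₁'⟩ := h₁ _ (hcase _ h2h)
      have hw' : w = ε * w₁ := by
        have h : (D₁.c : ℂ) * w = (D₁.c : ℂ) * (ε * w₁) := by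
          linear_combination ε * hw₁' - ((D₁.c : ℂ) * w) * hε2
        exact mul_left_cancel₀ hc₁ h
      rw [hw', ← hf]; exact hεmem _ _ hw₁
    have heq := natAbs_maninConstant₀_eq_of_periodLatticeGamma1_eq_periodLattice D₁ D₀ h₁ h₀ hf hΛ
    have hne : D₁.maninConstant.natAbs ≠ 0 := Int.natAbs_ne_zero.mpr D₁.maninConstant_ne_zero
    omega
  · -- index 2: Vélu rigidity with `L' = Λ_{E₁}`, the Néron lattice of the minimal model `W₁`
    right
    obtain ⟨z₀, hz₀', hz₀, hidx⟩ := hcase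
    obtain ⟨q, -, hroot, hA', hB'⟩ :=
      velu_two_rigidity D₀.isNeronLattice D₁.L hA hB hle hz₀' hz₀ (htwo z₀ hz₀') hidx
    refine ⟨q, hroot, ?_, ?_⟩
    · linear_combination 12 * hA'
    · linear_combination 216 * hB'

/-- **At `N = 4p`, `p` odd: doubling forces Vélu rigidity (any model)** — for the optimal pair of a class with `|c₀| = 2|c₁|`
there is a rational `2`-torsion point `T` of `W₀`, `x(T) = q − b₂/12`, with `c₄(W₁) = 720q² − 4c₄(W₀)` and
`c₆(W₁) = 19008q³ − 144c₄(W₀)q` on the MINIMAL model `W₁` (index `4` being impossible at these levels, p632017). -/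
theorem velu_two_of_doubled_four_mul_prime {p : ℕ} (hp : p.Prime) (hp2 : p ≠ 2) [NeZero (4 * p)]
    (D₁ : Gamma1ParametrizationData W₁ (4 * p)) (D₀ : ModularParametrizationData W₀ (4 * p))
    (hiso : IsIsogenous W₁ W₀) (h₁ : D₁.IsOptimal)
    (h₀ : ∀ z ∈ D₀.L.lattice, ∃ w ∈ periodLattice D₀.f, z = D₀.c * w)
    (hdouble : D₀.maninConstant.natAbs = 2 * D₁.maninConstant.natAbs) :
    ∃ q : ℚ, W₀.Ψ₂Sq.eval (q - W₀.b₂ / 12) = 0 ∧ W₁.c₄ = 720 * q ^ 2 - 4 * W₀.c₄ ∧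
      W₁.c₆ = 19008 * q ^ 3 - 144 * W₀.c₄ * q := by
  rcases index_four_or_velu_two_of_doubled D₁ D₀ hiso h₁ h₀ ⟨p, rfl⟩ hdouble with h | h
  · exact absurd h (not_periodLatticeGamma1_eq_two_mul_of_four_mul_prime hp hp2 D₀ h₀)
  · exact h

end Summit.BirchSwinnertonDyer.BirchSwinnertonDyer.Theorems.ManinLocalTwoThree

end
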